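import Literature.MathematicalPhysics.QuantumFieldTheory.Balaban1983to89.B9Eq325QGGQInvZdPer
import Literature.MathematicalPhysics.QuantumFieldTheory.Balaban1983to89.B9Eq325ProjFormulaZd

/-!
# `Balaban1983to89.B9Eq325ProjFormulaZdPer` — [Balaban1985BackgroundPropagators] (3.25) p. 394 ON THE TORUS `T_P` READ ON `ℤᵈ`: PRINT's LAGRANGE-MULTIPLIER FORMULA
# `R f = f − G′Q′*(Q′G′²Q′*)⁻¹Q′G′ f` EQUALS THE ORTHOGONAL PROJECTION `R(U₀)` OF (3.21)–(3.22) on `L²(T_P, 𝔤)` (`B9Eq321LandauProjectionZdPer.projEPer`) on HERMITIAN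
# inputs — at every unitary periodic background with unitary averaged transporters, in the regime where `Δ′_a(U₀)` is invertible and `Q′*` injective; the
# periodic twin of `B9Eq325ProjFormulaZd`, third link of the (3.25) chain on the torus

statement-level skeleton of published theorems with citation tags; proofs where landed; nothing here is a claim about the
Yang–Mills mass gap

`[Balaban1985BackgroundPropagators]` ("B9", CMP **99** (1985) 389–434) p. 394: *«R = R(U) is an orthogonal projection in the Hilbert space L²(Ω₀, g) onto the subspace
R = Δ^η_U N(Q′) … (3.21) … Rf = Δ^η_U λ₀, where λ₀ is a minimum of the function λ ∈ N(Q′), λ → ‖f − Δ^η_U λ‖² (3.22) … To find λ₀ we use Lagrange multipliers and we get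
Rf = f − G′Q′*(Q′G′²Q′*)⁻¹Q′G′f. (3.25) Of course this formula holds if Δ′_a, Q′G′²Q′* are invertible»*.  `[Balaban1984PropagatorsI]` (1.42)–(1.44) p. 25 (the same algebra,
one level).  `[Balaban1985RegularSpaces]` p. 77 *«Ω_j = T_η»*.  PDF held: `paper:balaban1985-cmp99-background-propagators` pp. 393–395.

CITATION HEADER (lean-in-tree rule).  Cell `pub-ymgap` (YM Track A), DAG node N06 = [B9], width seat `pub-ymgap-dag-n06-w4` (g6), the (β′-PERIODIC) road.  WHY: the
record's periodic gauge-fixing projection `projRPer` (this seat g5) is defined ABSTRACTLY (orthogonal projection onto a `U₀`-dependent subspace); its CONTINUITY in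
`U₀` — the input of the openness engine that gives Thm 3.11 near the flat background — is read off (3.25), whose letters `G′ ∕ Q′ ∕ Q′* ∕ (Q′G′²Q′*)⁻¹` (companions
`B9Eq324DeltaPrimeAZdPer`, `B9Eq325QGGQInvZdPer`) are explicit stencils continuous in `U₀`.  THIS FILE proves (3.25) = `projEPer` on Hermitian periodic inputs.  The
star-compatibility letters at the site level (`starFun`, `star_QprimeIter`, `covLap_starFun`, `eq_of_fibreForm_eq`) are the Dirichlet twin's, imported BY NAME;
nothing is re-declared.  RELATED, NOT DUPLICATED: lit-balaban t2s-1's `B9B8KnitLandauProjection.projRPer_eq_liftL_RY` (p642020) identifies `projRPer` with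
def-Y's Lagrange letter `Node00.OpsYDeltaA.RY` at the knit's torus datum (`𝔸 = M_N(ℂ)`, `τ = tr`, constant level, transporters `parKnitY`); THIS FILE is the
identification for the dag-n06 STENCIL letters (`GpPer ∕ QprimeVecPer ∕ QprimeStarPer ∕ cPer`, any C⋆-fibre, any level-periodic `Λ_j`), the ones whose
continuity in `U₀` the next file proves.

WHAT IS DECLARED ∕ PROVED (kernel, 0 sorry; 3 plumbing `def`s + theorems; no `instance`, no `notation`).
* §1 `starPerSub` ∕ `starLevPer` (the involutions `f ↦ f*` of `L²(T_P, ·)` and `L²(𝔅_P, ·)`), `coe_starPerSub ∕ starPerSub_starPerSub ∕ coe_starLevPer ∕ starLevPer_starLevPer`.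
* §2 (star-compatibility, unitary `U₀`, UNITARY averaged transporters `hT`, tracial Hermitian `τ`) `star_qprimeT1 ∕ star_QprimeT ∕ star_QT` (the transpose stencils
  commute with `*`), `penaltyMult_starFun`, ★ `deltaPrimeAPerFun_starFun`, `starPerSub_deltaPrimeAPer`, ★ `starPerSub_GpPer` (in the regime), `starLevPer_QprimeVecPer`,
  `starPerSub_QprimeStarPer`, `starLevPer_qggqPer`, `starLevPer_cPer`.
* §3 (the Lagrange algebra) ★ `RopPer` (`R f := f − G′(Q′*(c(Q′(G′f))))` on `L²(T_P, ·)`), `RopPer_def`, ★ `QprimeVecPer_GpPer_RopPer` (`Q′G′(Rf) = 0`),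
  `penaltyMult_indicator_eq_zero_of_ker` ∕ ★ `deltaPrimeAPerFun_of_ker` (on `N(Q′)` the penalty vanishes: `Δ′_a λ = Δ^η_{U₀}λ`), `qprimeIter_GpPer_RopPer_eq_zero`
  (`λ₀ := G′Rf ∈ N^per(Q′(U₀))`), ★ `coe_RopPer_eq_covLap` (`Rf = Δ^η_{U₀}λ₀`), ★ `formPer_deltaPrimeAPer_sub_RopPer` (`f − Rf ⊥ Δ′_a λ` for `λ ∈ N`), `starPerSub_RopPer`,
  ★ `isSelfAdjoint_lam0Per` (Hermitian `f` ⟹ `λ₀` Hermitian-valued).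
* §4 ★★★ `projEPer_eq_RopPer_of_herm` ((3.25) = `projEPer` ON HERMITIAN PERIODIC INPUTS) and ★★ `coe_projRPer_eq_RopPer_of_herm` (the same for `projRPer` on a periodic
  Hermitian-valued site function).

HONEST SCOPE.  (i) Finite-dimensional linear algebra; no estimate; the identification is RELATIVE to the regime (`Δ′_a(U₀)` invertible — at `U₀ = 1` by
`B9Eq324DeltaPrimeAZdPer.regularPrimePer_one` — and `Q′*` injective — one active level suffices, `B9Eq325QGGQInvZdPer`).  (ii) Unitary averaged transporters are
DISPLAYED ([B7] Prop. 2's output; trivially true at `U₀ = 1`).  (iii) On NON-Hermitian inputs (3.25) and `projEPer` differ (the latter projects onto a `𝔤`-valued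
span) — not claimed.  (iv) Count-neutral; N05 ∕ N06 NOT discharged; K1⁹ `stmt-QuantumFields-27364` NOT closed; one finite `𝕋⁴` programme at fixed `ε`, Bałaban as
printed; R4 closes only the conditional finite-`𝕋⁴` rung `BalabanLadder.UV` — nothing continuum ∕ ℝ⁴ ∕ OS ∕ mass gap ∕ Clay.  Unit `pub-ymgap-dag-n06-w4` (g6), 2026-08-28.
-/

noncomputable section

namespace Literature.MathematicalPhysics.QuantumFieldTheory.Balaban1983to89.B9Eq325ProjFormulaZdPer

open B7Prop1Explicit B7Eq78Linearization
open B7Prop2Explicit (unitaryUnits)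
open B8Eq119TwistedAxial (bgT)
open B8Eq138LandauZd (covLap qprimeT1 QprimeT QT)
open T4TermwiseTorus (IsPeriodic box mem_box tcls tlift tlift_mem_box tlift_tcls_of_mem_box)
open B9Eq321LandauProjectionZd (star_conjR_of_mem_unitaryUnits star_covLap)
open B9Eq321LandauProjectionZdPer (perSub formPer formPer_apply formPer_isSymm perRestrict perRestrict_mem_perSub perRestrict_eq_self
  gaugeNullPer rangeGenPer rangeSubPer projEPer projRPer isCompl_rangeSubPer_orthogonal projEPer_eq_projection)
open B9Eq321LandauMultiplierIffZdPer (isPeriodic_QprimeIter eq_pow_mul_div_of_dvd)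
open B9Eq324DeltaPrimeAZd (fibreForm fibreForm_apply)
open B9Eq324DeltaPrimeAZdPer (penaltyMult deltaPrimeAPerFun deltaPrimeAPerFun_apply deltaPrimeAPer deltaPrimeAPer_coe_apply deltaPrimeAPer_coe GpPer
  RegularPrimePer deltaPrimeAPer_GpPer GpPer_deltaPrimeAPer formPer_GpPer_symm formPer_deltaPrimeAPer_symm)
open B9Eq325QGGQInvZdPer (InSat inSat_iff_mem levPer QprimeVecPer QprimeVecPer_apply QprimeStarPer QprimeStarPer_coe formPer_qprimeStarPer qggqPer
  qggqPer_apply qggqPer_bijective QprimeStarPerInjective cPer qggqPer_cPer cPer_qggqPer neZero_div_pow)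
open B9Eq325ProjFormulaZd (starFun starFun_apply starFun_starFun star_QprimeIter covLap_starFun)

-- `Site` alone could resolve to the torus sites of `Setup.lean`; re-export the `ℤ^d` sites of `B7Prop1Explicit`.
export B7Prop1Explicit (Site)

variable {d : ℕ} {𝔸 : Type*} [CStarAlgebra 𝔸]

/-! ## §1  The involutions of `L²(T_P, ·)` and `L²(𝔅_P, ·)` -/

section Star

variable {P L m : ℕ} {Λs : ℕ → Set (Site d)}

/-- **THE INVOLUTION OF `L²(T_P, ·)`** (`f ↦ f*`; periodicity is preserved). [cite: Balaban1985BackgroundPropagators, (3.21) p.394 («L²(Ω₀, 𝔤)» — the Hermitian part)] -/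
def starPerSub (f : perSub (𝔸 := 𝔸) (d := d) P) : perSub (𝔸 := 𝔸) (d := d) P :=
  ⟨starFun (f : Site d → 𝔸), fun x n => by rw [starFun_apply, starFun_apply, f.2 x n]⟩

/-- `starPerSub`, unfolded. [cite: Balaban1985BackgroundPropagators, (3.21) p.394 (bookkeeping)] -/
@[simp] theorem coe_starPerSub (f : perSub (𝔸 := 𝔸) (d := d) P) : ((starPerSub f : perSub (𝔸 := 𝔸) (d := d) P) : Site d → 𝔸) = starFun (f : Site d → 𝔸) :=
  rfl

/-- `starPerSub` is an involution. [cite: Balaban1985BackgroundPropagators, (3.21) p.394 (bookkeeping)] -/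
@[simp] theorem starPerSub_starPerSub (f : perSub (𝔸 := 𝔸) (d := d) P) : starPerSub (starPerSub f) = f := Subtype.ext (starFun_starFun _)

/-- **THE INVOLUTION OF `L²(𝔅_P, ·)`** (level periodicity and supports are preserved). [cite: Balaban1985BackgroundPropagators, (3.24) p.394] -/
def starLevPer (φ : levPer (𝔸 := 𝔸) (d := d) P L m Λs) : levPer (𝔸 := 𝔸) (d := d) P L m Λs :=
  ⟨starFun (φ : ℕ × Site d → 𝔸),
    ⟨fun j y n => congrArg star (φ.2.1 j y n), fun p hp => by rw [starFun_apply, φ.2.2 p hp, star_zero]⟩⟩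

/-- `starLevPer`, unfolded. [cite: Balaban1985BackgroundPropagators, (3.24) p.394 (bookkeeping)] -/
@[simp] theorem coe_starLevPer (φ : levPer (𝔸 := 𝔸) (d := d) P L m Λs) :
    ((starLevPer φ : levPer (𝔸 := 𝔸) (d := d) P L m Λs) : ℕ × Site d → 𝔸) = starFun (φ : ℕ × Site d → 𝔸) := rfl

/-- `starLevPer` is an involution. [cite: Balaban1985BackgroundPropagators, (3.24) p.394 (bookkeeping)] -/
@[simp] theorem starLevPer_starLevPer (φ : levPer (𝔸 := 𝔸) (d := d) P L m Λs) : starLevPer (starLevPer φ) = φ := Subtype.ext (starFun_starFun _)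

end Star

/-! ## §2  Star-compatibility of the transpose stencils, `Δ′_a`, `G′`, `Q′`, `Q′*`, `Q′G′²Q′*`, `(Q′G′²Q′*)⁻¹` on the torus -/

section Compat

variable {L : ℕ} {U₀ : Site d → Fin d → 𝔸ˣ} {η : ℝ} {m : ℕ} {a : ℕ → ℝ} {Λs : ℕ → Set (Site d)} {P : ℕ}

/-- **THE ONE-STEP TRANSPOSE COMMUTES WITH `*`** for unitary averaged transporters (`(R(u)a)* = R(u)a*` for unitary `u`, real weights).
[cite: Balaban1985BackgroundPropagators, (3.19) p.393; Balaban1985Averaging, Prop. 2 p.26] -/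
theorem star_qprimeT1 (hT : ∀ (j : ℕ) (z y : Site d), bgT L U₀ j z y ∈ unitaryUnits 𝔸) (j : ℕ) (ν : Site d → 𝔸) (x : Site d) :
    star (qprimeT1 L U₀ j ν x) = qprimeT1 L U₀ j (starFun ν) x := by
  rw [qprimeT1, qprimeT1, star_smul, star_trivial, star_conjR_of_mem_unitaryUnits ((unitaryUnits 𝔸).inv_mem (hT j _ x)), starFun_apply]

/-- **`Q′_j(U₀)ᵀ` COMMUTES WITH `*`** (unitary averaged transporters). [cite: Balaban1985BackgroundPropagators, (3.19) p.393, (3.24) p.394] -/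
theorem star_QprimeT (hT : ∀ (j : ℕ) (z y : Site d), bgT L U₀ j z y ∈ unitaryUnits 𝔸) :
    ∀ (j : ℕ) (ν : Site d → 𝔸) (x : Site d), star (QprimeT L U₀ j ν x) = QprimeT L U₀ j (starFun ν) x := by
  intro j
  induction j with
  | zero => intro ν x; rfl
  | succ j ih =>
    intro ν x
    show star (QprimeT L U₀ j (qprimeT1 L U₀ j ν) x) = QprimeT L U₀ j (qprimeT1 L U₀ j (starFun ν)) x
    rw [ih]
    congr 1
    funext y
    exact (star_qprimeT1 hT j ν y).symm ▸ rfl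

/-- **`Q′(U₀)ᵀμ` COMMUTES WITH `*`** (levelwise involution of the multiplier; indicators commute with `*`). [cite: Balaban1985BackgroundPropagators, (3.24) p.394] -/
theorem star_QT (hT : ∀ (j : ℕ) (z y : Site d), bgT L U₀ j z y ∈ unitaryUnits 𝔸) (μ : ℕ → Site d → 𝔸) (x : Site d) :
    star (QT L m Λs U₀ μ x) = QT L m Λs U₀ (fun j => starFun (μ j)) x := by
  rw [QT, QT, star_sum]
  refine Finset.sum_congr rfl fun j _ => ?_
  rw [star_QprimeT hT]
  congr 1
  funext y
  by_cases hy : y ∈ Λs j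
  · rw [starFun_apply, Set.indicator_of_mem hy, Set.indicator_of_mem hy, starFun_apply]
  · rw [starFun_apply, Set.indicator_of_notMem hy, Set.indicator_of_notMem hy, star_zero]

/-- the penalty multiplier of `f*` is the levelwise involution of that of `f` (unitary averaged transporters, real weights).
[cite: Balaban1985BackgroundPropagators, (3.24) p.394 (bookkeeping)] -/
theorem penaltyMult_starFun (hT : ∀ (j : ℕ) (z y : Site d), bgT L U₀ j z y ∈ unitaryUnits 𝔸) (f : Site d → 𝔸) (j : ℕ) :
    penaltyMult L U₀ a (starFun f) j = starFun (penaltyMult L U₀ a f j) := by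
  funext y
  simp only [penaltyMult, starFun_apply, star_smul, star_trivial, star_QprimeIter hT f j y]

/-- ★ **`Δ′_a(U₀)(f*) = (Δ′_a(U₀)f)*`** for the torus stencil (unitary `U₀`, unitary averaged transporters).
[cite: Balaban1985BackgroundPropagators, (3.24) p.394] -/
theorem deltaPrimeAPerFun_starFun (hU : ∀ (x : Site d) (κ : Fin d), U₀ x κ ∈ unitaryUnits 𝔸)
    (hT : ∀ (j : ℕ) (z y : Site d), bgT L U₀ j z y ∈ unitaryUnits 𝔸) (f : Site d → 𝔸) :
    deltaPrimeAPerFun L U₀ η m a Λs (starFun f) = starFun (deltaPrimeAPerFun L U₀ η m a Λs f) := by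
  funext x
  rw [deltaPrimeAPerFun_apply, starFun_apply, deltaPrimeAPerFun_apply, star_add, covLap_starFun hU, starFun_apply, star_QT hT]
  congr 2
  funext j
  exact penaltyMult_starFun hT f j

/-- **`Δ′_a(U₀)` ON `L²(T_P, ·)` COMMUTES WITH THE INVOLUTION** (every `U₀` with unitary bonds and unitary averaged transporters).
[cite: Balaban1985BackgroundPropagators, (3.24) p.394] -/
theorem starPerSub_deltaPrimeAPer (hU : ∀ (x : Site d) (κ : Fin d), U₀ x κ ∈ unitaryUnits 𝔸)
    (hT : ∀ (j : ℕ) (z y : Site d), bgT L U₀ j z y ∈ unitaryUnits 𝔸) (f : perSub (𝔸 := 𝔸) (d := d) P) :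
    deltaPrimeAPer L U₀ η m a Λs P (starPerSub f) = starPerSub (deltaPrimeAPer L U₀ η m a Λs P f) := by
  apply Subtype.ext
  funext x
  rw [deltaPrimeAPer_coe_apply, coe_starPerSub, coe_starPerSub, deltaPrimeAPerFun_starFun hU hT, starFun_apply, starFun_apply, deltaPrimeAPer_coe_apply]

/-- ★ **`G′(U₀)(f*) = (G′(U₀)f)*`** in the regime — the inverse of the `*`-compatible bijection `Δ′_a(U₀)`. [cite: Balaban1985BackgroundPropagators, (3.24)–(3.25) p.394] -/
theorem starPerSub_GpPer (hU : ∀ (x : Site d) (κ : Fin d), U₀ x κ ∈ unitaryUnits 𝔸)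
    (hT : ∀ (j : ℕ) (z y : Site d), bgT L U₀ j z y ∈ unitaryUnits 𝔸) (hreg : RegularPrimePer L U₀ η m a Λs P) (f : perSub (𝔸 := 𝔸) (d := d) P) :
    GpPer L U₀ η m a Λs P (starPerSub f) = starPerSub (GpPer L U₀ η m a Λs P f) := by
  apply hreg.1
  rw [deltaPrimeAPer_GpPer hreg, starPerSub_deltaPrimeAPer hU hT, deltaPrimeAPer_GpPer hreg]

/-- **`Q′(f*) = (Q′f)*`** on `L²(T_P, ·) → L²(𝔅_P, ·)` (unitary averaged transporters). [cite: Balaban1985BackgroundPropagators, (3.19) p.393] -/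
theorem starLevPer_QprimeVecPer (hT : ∀ (j : ℕ) (z y : Site d), bgT L U₀ j z y ∈ unitaryUnits 𝔸) (f : perSub (𝔸 := 𝔸) (d := d) P) :
    QprimeVecPer P L U₀ m Λs (starPerSub f) = starLevPer (QprimeVecPer P L U₀ m Λs f) := by
  classical
  apply Subtype.ext
  funext p
  obtain ⟨j, y⟩ := p
  rw [coe_starLevPer, starFun_apply, QprimeVecPer_apply, QprimeVecPer_apply, coe_starPerSub]
  split_ifs with h
  · rw [star_QprimeIter hT]
  · rw [star_zero]

/-- **`Q′*(φ*) = (Q′*φ)*`** (the transpose stencils are `*`-compatible). [cite: Balaban1985BackgroundPropagators, (3.25) p.394] -/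
theorem starPerSub_QprimeStarPer (hT : ∀ (j : ℕ) (z y : Site d), bgT L U₀ j z y ∈ unitaryUnits 𝔸) (φ : levPer (𝔸 := 𝔸) (d := d) P L m Λs) :
    QprimeStarPer P L U₀ m Λs (starLevPer φ) = starPerSub (QprimeStarPer P L U₀ m Λs φ) := by
  apply Subtype.ext
  funext x
  rw [QprimeStarPer_coe, coe_starPerSub, starFun_apply, QprimeStarPer_coe]
  show QT L m _ U₀ (fun j y => star ((φ : ℕ × Site d → 𝔸) (j, y))) (tlift (tcls P x)) = star (QT L m _ U₀ (fun j y => (φ : ℕ × Site d → 𝔸) (j, y)) (tlift (tcls P x)))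
  rw [star_QT hT]
  rfl

/-- **`Q′G′²Q′*` COMMUTES WITH THE INVOLUTION** (in the regime). [cite: Balaban1985BackgroundPropagators, (3.25) p.394] -/
theorem starLevPer_qggqPer (hU : ∀ (x : Site d) (κ : Fin d), U₀ x κ ∈ unitaryUnits 𝔸)
    (hT : ∀ (j : ℕ) (z y : Site d), bgT L U₀ j z y ∈ unitaryUnits 𝔸) (hreg : RegularPrimePer L U₀ η m a Λs P) (φ : levPer (𝔸 := 𝔸) (d := d) P L m Λs) :
    qggqPer P L U₀ η m a Λs (starLevPer φ) = starLevPer (qggqPer P L U₀ η m a Λs φ) := by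
  rw [qggqPer_apply, qggqPer_apply, starPerSub_QprimeStarPer hT, starPerSub_GpPer hU hT hreg, starPerSub_GpPer hU hT hreg, starLevPer_QprimeVecPer hT]

/-- ★ **`(Q′G′²Q′*)⁻¹(φ*) = ((Q′G′²Q′*)⁻¹φ)*`** (in the regime, `Q′G′²Q′*` bijective). [cite: Balaban1985BackgroundPropagators, (3.25) p.394] -/
theorem starLevPer_cPer (hU : ∀ (x : Site d) (κ : Fin d), U₀ x κ ∈ unitaryUnits 𝔸)
    (hT : ∀ (j : ℕ) (z y : Site d), bgT L U₀ j z y ∈ unitaryUnits 𝔸) (hreg : RegularPrimePer L U₀ η m a Λs P)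
    (hb : Function.Bijective (qggqPer (𝔸 := 𝔸) (d := d) P L U₀ η m a Λs)) (φ : levPer (𝔸 := 𝔸) (d := d) P L m Λs) :
    cPer P L U₀ η m a Λs (starLevPer φ) = starLevPer (cPer P L U₀ η m a Λs φ) := by
  apply hb.1
  rw [qggqPer_cPer hb, starLevPer_qggqPer hU hT hreg, qggqPer_cPer hb]

end Compat

/-! ## §3  The Lagrange-multiplier algebra for `R f := f − G′Q′*(Q′G′²Q′*)⁻¹Q′G′f` on the torus -/

section Lagrange

variable (P L : ℕ) (U₀ : Site d → Fin d → 𝔸ˣ) (η : ℝ) (m : ℕ) (a : ℕ → ℝ) (Λs : ℕ → Set (Site d))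

/-- ★ **PRINT'S (3.25) OPERATOR ON THE TORUS LETTERS**: `R f := f − G′(Q′*((Q′G′²Q′*)⁻¹(Q′(G′f))))` on `L²(T_P, ·)` (all four letters total objects, every `U₀`).
[cite: Balaban1985BackgroundPropagators, (3.25) p.394] -/
def RopPer (f : perSub (𝔸 := 𝔸) (d := d) P) : perSub (𝔸 := 𝔸) (d := d) P :=
  f - GpPer L U₀ η m a Λs P (QprimeStarPer P L U₀ m Λs (cPer P L U₀ η m a Λs (QprimeVecPer P L U₀ m Λs (GpPer L U₀ η m a Λs P f))))

/-- `RopPer`, unfolded. [cite: Balaban1985BackgroundPropagators, (3.25) p.394 (bookkeeping)] -/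
theorem RopPer_def (f : perSub (𝔸 := 𝔸) (d := d) P) :
    RopPer P L U₀ η m a Λs f =
      f - GpPer L U₀ η m a Λs P (QprimeStarPer P L U₀ m Λs (cPer P L U₀ η m a Λs (QprimeVecPer P L U₀ m Λs (GpPer L U₀ η m a Λs P f)))) := rfl

variable {P L U₀ η m a Λs}

/-- ★ **`Q′G′(Rf) = 0`** — the multiplier is chosen so that `λ₀ := G′Rf` satisfies the constraint «Q′λ₀ = 0» ((3.22): λ₀ ∈ N(Q′)); requires `Q′G′²Q′*` bijective.
[cite: Balaban1985BackgroundPropagators, (3.22), (3.25) p.394; Balaban1984PropagatorsI, (1.43) p.25] -/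
theorem QprimeVecPer_GpPer_RopPer (hb : Function.Bijective (qggqPer (𝔸 := 𝔸) (d := d) P L U₀ η m a Λs)) (f : perSub (𝔸 := 𝔸) (d := d) P) :
    QprimeVecPer P L U₀ m Λs (GpPer L U₀ η m a Λs P (RopPer P L U₀ η m a Λs f)) = 0 := by
  rw [RopPer_def, map_sub, map_sub, ← qggqPer_apply, qggqPer_cPer hb, sub_self]

/-- the penalty multiplier of a function annihilated by `Q′_j` on `Λ_j` has zero restriction to `Λ_j`. [cite: Balaban1985BackgroundPropagators, (3.24) p.394 (bookkeeping)] -/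
theorem penaltyMult_indicator_eq_zero_of_ker {lam : Site d → 𝔸}
    (hker : ∀ j, j ≤ m → ∀ y ∈ Λs j, QprimeIter (zdBlocking d L) (bgT L U₀) j lam y = 0) {j : ℕ} (hj : j ≤ m) :
    (Λs j).indicator (penaltyMult L U₀ a lam j) = 0 := by
  funext y
  by_cases hy : y ∈ Λs j
  · rw [Set.indicator_of_mem hy, Pi.zero_apply]
    show a j • QprimeIter (zdBlocking d L) (bgT L U₀) j lam y = 0
    rw [hker j hj y hy, smul_zero]
  · rw [Set.indicator_of_notMem hy, Pi.zero_apply]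

/-- ★ **ON `N(Q′)` THE PENALTY VANISHES: `Δ′_a(U₀)λ = Δ^η_{U₀}λ`** (as stencils, every site) for `λ` with `Q′_j(U₀)λ = 0` on `Λ_j`, `j ≤ m` (B5's «Δ′_a agrees with Δ on
N(Q′)»). [cite: Balaban1985BackgroundPropagators, (3.24) p.394; Balaban1984PropagatorsI, (1.42)–(1.44) p.25] -/
theorem deltaPrimeAPerFun_of_ker {lam : Site d → 𝔸}
    (hker : ∀ j, j ≤ m → ∀ y ∈ Λs j, QprimeIter (zdBlocking d L) (bgT L U₀) j lam y = 0) :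
    deltaPrimeAPerFun L U₀ η m a Λs lam = covLap η U₀ lam := by
  funext x
  rw [deltaPrimeAPerFun_apply, add_eq_left, QT]
  refine Finset.sum_eq_zero fun j hj => ?_
  rw [penaltyMult_indicator_eq_zero_of_ker hker (Nat.lt_succ_iff.1 (Finset.mem_range.1 hj)), B8Eq138LandauZd.QprimeT_zero]

variable [NeZero P]

/-- **`λ₀ := G′Rf ∈ N^per(Q′(U₀))`**: at a periodic `U₀`, `Lᵐ ∣ P`, level-periodic `Λ_j`, and `Q′G′²Q′*` bijective, `(Q′_j(U₀)λ₀)(y) = 0` for every `y ∈ Λ_j`, `j ≤ m`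
(from `Q′G′(Rf) = 0`, read back from representatives by the periodicity of `Q′_jλ₀`). [cite: Balaban1985BackgroundPropagators, (3.22), (3.25) p.394] -/
theorem qprimeIter_GpPer_RopPer_eq_zero (hU : IsPeriodic P U₀) (hP : L ^ m ∣ P)
    (hΛ : ∀ j, j ≤ m → IsPeriodic (P / L ^ j) fun y => y ∈ Λs j) (hb : Function.Bijective (qggqPer (𝔸 := 𝔸) (d := d) P L U₀ η m a Λs))
    (f : perSub (𝔸 := 𝔸) (d := d) P) {j : ℕ} (hj : j ≤ m) {y : Site d} (hy : y ∈ Λs j) :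
    QprimeIter (zdBlocking d L) (bgT L U₀) j ((GpPer L U₀ η m a Λs P (RopPer P L U₀ η m a Λs f) : perSub (𝔸 := 𝔸) (d := d) P) : Site d → 𝔸) y = 0 := by
  classical
  set lam := GpPer L U₀ η m a Λs P (RopPer P L U₀ η m a Λs f) with hlam
  haveI := neZero_div_pow (P := P) hP hj
  have hsat : InSat P L Λs j y := (inSat_iff_mem P L Λs (hΛ j hj) y).2 hy
  have h := congrArg (fun φ : levPer (𝔸 := 𝔸) (d := d) P L m Λs => (φ : ℕ × Site d → 𝔸) (j, y)) (QprimeVecPer_GpPer_RopPer hb f)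
  simp only [Submodule.coe_zero, Pi.zero_apply] at h
  rw [QprimeVecPer_apply, if_pos ⟨hj, hsat⟩] at h
  have hper : IsPeriodic (P / L ^ j) (QprimeIter (zdBlocking d L) (bgT L U₀) j (lam : Site d → 𝔸)) :=
    isPeriodic_QprimeIter hU lam.2 (eq_pow_mul_div_of_dvd hP hj)
  rw [← IsPeriodic.apply_tlift hper y]
  exact h

/-- ★ **`Rf = Δ^η_{U₀}λ₀` with `λ₀ := G′Rf ∈ N^per(Q′)`** ((3.22) «Rf = Δ^η_Uλ₀»), as site functions, at a periodic `U₀` in the regime (`L ≥ 1`, `Lᵐ ∣ P`, `Λ_j`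
level-periodic, `Q′G′²Q′*` bijective). [cite: Balaban1985BackgroundPropagators, (3.22) p.394; Balaban1984PropagatorsI, (1.43) p.25] -/
theorem coe_RopPer_eq_covLap (hL : 1 ≤ L) (hU : IsPeriodic P U₀) (hP : L ^ m ∣ P) (hΛ : ∀ j, j ≤ m → IsPeriodic (P / L ^ j) fun y => y ∈ Λs j)
    (hreg : RegularPrimePer L U₀ η m a Λs P) (hb : Function.Bijective (qggqPer (𝔸 := 𝔸) (d := d) P L U₀ η m a Λs)) (f : perSub (𝔸 := 𝔸) (d := d) P) :
    ((RopPer P L U₀ η m a Λs f : perSub (𝔸 := 𝔸) (d := d) P) : Site d → 𝔸) =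
      covLap η U₀ ((GpPer L U₀ η m a Λs P (RopPer P L U₀ η m a Λs f) : perSub (𝔸 := 𝔸) (d := d) P) : Site d → 𝔸) := by
  set lam := GpPer L U₀ η m a Λs P (RopPer P L U₀ η m a Λs f) with hlam
  have hker : ∀ j, j ≤ m → ∀ y ∈ Λs j, QprimeIter (zdBlocking d L) (bgT L U₀) j (lam : Site d → 𝔸) y = 0 :=
    fun j hj y hy => qprimeIter_GpPer_RopPer_eq_zero hU hP hΛ hb f hj hy
  rw [← deltaPrimeAPerFun_of_ker (η := η) (a := a) hker, ← deltaPrimeAPer_coe η a hL hU hP hΛ lam, hlam, deltaPrimeAPer_GpPer hreg]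

variable (τ : 𝔸 →ₗ[ℂ] ℂ)

/-- ★ **`f − Rf ⊥ Δ′_a(U₀)λ` FOR EVERY `λ` ANNIHILATED BY `Q′`** («f − Rf ⊥ Δ^η_U N(Q′)», since `Δ′_a λ = Δ^η_{U₀}λ` there): `⟨Δ′_aλ, G′Q′*ψ⟩ = ⟨λ, Q′*ψ⟩ = ⟨ψ, Q′λ⟩ = 0`
— symmetry of `Δ′_a` (unitary periodic `U₀`, unitary averaged transporters, `Lᵐ ∣ P`), the regime, and the adjointness on the cell.
[cite: Balaban1985BackgroundPropagators, (3.21)–(3.22) p.394; Balaban1984PropagatorsI, (1.42)–(1.44) p.25] -/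
theorem formPer_deltaPrimeAPer_sub_RopPer [NeZero L] (hτt : ∀ a b : 𝔸, τ (a * b) = τ (b * a)) (hτs : ∀ a : 𝔸, τ (star a) = starRingEnd ℂ (τ a))
    (hUu : ∀ (x : Site d) (κ : Fin d), U₀ x κ ∈ unitaryUnits 𝔸) (hT : ∀ (j : ℕ) (z y : Site d), bgT L U₀ j z y ∈ unitaryUnits 𝔸)
    (hU : IsPeriodic P U₀) (hP : L ^ m ∣ P) (hreg : RegularPrimePer L U₀ η m a Λs P) (lam : perSub (𝔸 := 𝔸) (d := d) P)
    (hQ : QprimeVecPer P L U₀ m Λs lam = 0) (f : perSub (𝔸 := 𝔸) (d := d) P) :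
    formPer τ P (deltaPrimeAPer L U₀ η m a Λs P lam) (f - RopPer P L U₀ η m a Λs f) = 0 := by
  rw [RopPer_def, sub_sub_cancel]
  set ψ := cPer P L U₀ η m a Λs (QprimeVecPer P L U₀ m Λs (GpPer L U₀ η m a Λs P f))
  have hΔsymm := fun f g => formPer_deltaPrimeAPer_symm τ hτt hτs hUu hT hU hP (η := η) (a := a) (Λs := Λs) f g
  -- `⟨Δ′λ, G′v⟩ = ⟨v, G′(Δ′λ)⟩`-type moves: first `⟨Δ′λ, G′v⟩ = ⟨G′v, Δ′λ⟩ = ⟨λ, Δ′(G′v)⟩ = ⟨λ, v⟩`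
  have h1 : formPer τ P (deltaPrimeAPer L U₀ η m a Λs P lam) (GpPer L U₀ η m a Λs P (QprimeStarPer P L U₀ m Λs ψ)) =
      formPer τ P lam (QprimeStarPer P L U₀ m Λs ψ) := by
    rw [(formPer_isSymm τ P hτs).eq, hΔsymm, deltaPrimeAPer_GpPer hreg]
  rw [h1, (formPer_isSymm τ P hτs).eq, formPer_qprimeStarPer τ hτt hτs hT hP, hQ, map_zero]

omit [NeZero P] in
/-- **`R` COMMUTES WITH THE INVOLUTION** (unitary `U₀` and averaged transporters, in the regime, `Q′G′²Q′*` bijective): `R(f*) = (Rf)*`.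
[cite: Balaban1985BackgroundPropagators, (3.25) p.394] -/
theorem starPerSub_RopPer (hUu : ∀ (x : Site d) (κ : Fin d), U₀ x κ ∈ unitaryUnits 𝔸) (hT : ∀ (j : ℕ) (z y : Site d), bgT L U₀ j z y ∈ unitaryUnits 𝔸)
    (hreg : RegularPrimePer L U₀ η m a Λs P) (hb : Function.Bijective (qggqPer (𝔸 := 𝔸) (d := d) P L U₀ η m a Λs)) (f : perSub (𝔸 := 𝔸) (d := d) P) :
    RopPer P L U₀ η m a Λs (starPerSub f) = starPerSub (RopPer P L U₀ η m a Λs f) := by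
  rw [RopPer_def, RopPer_def, starPerSub_GpPer hUu hT hreg f, starLevPer_QprimeVecPer hT, starLevPer_cPer hUu hT hreg hb, starPerSub_QprimeStarPer hT,
    starPerSub_GpPer hUu hT hreg]
  apply Subtype.ext
  funext x
  simp only [Submodule.coe_sub, Pi.sub_apply, coe_starPerSub, starFun_apply, star_sub]

omit [NeZero P] in
/-- ★ **FOR A HERMITIAN `f`, `λ₀ := G′Rf` IS HERMITIAN-VALUED** — so `Rf = Δ^η_{U₀}λ₀` lies in the `𝔤`-valued range of the record's `R(U₀)` on the torus.
[cite: Balaban1985BackgroundPropagators, (3.21)–(3.22) p.394 («L²(Ω₀, 𝔤)»)] -/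
theorem isSelfAdjoint_lam0Per (hUu : ∀ (x : Site d) (κ : Fin d), U₀ x κ ∈ unitaryUnits 𝔸) (hT : ∀ (j : ℕ) (z y : Site d), bgT L U₀ j z y ∈ unitaryUnits 𝔸)
    (hreg : RegularPrimePer L U₀ η m a Λs P) (hb : Function.Bijective (qggqPer (𝔸 := 𝔸) (d := d) P L U₀ η m a Λs))
    {f : perSub (𝔸 := 𝔸) (d := d) P} (hf : starPerSub f = f) (x : Site d) :
    IsSelfAdjoint (((GpPer L U₀ η m a Λs P (RopPer P L U₀ η m a Λs f) : perSub (𝔸 := 𝔸) (d := d) P) : Site d → 𝔸) x) := by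
  have h : starPerSub (GpPer L U₀ η m a Λs P (RopPer P L U₀ η m a Λs f)) = GpPer L U₀ η m a Λs P (RopPer P L U₀ η m a Λs f) := by
    rw [← starPerSub_GpPer hUu hT hreg, ← starPerSub_RopPer hUu hT hreg hb, hf]
  have hx := congrArg (fun g : perSub (𝔸 := 𝔸) (d := d) P => (g : Site d → 𝔸) x) h
  simp only [coe_starPerSub, starFun_apply] at hx
  exact hx

end Lagrange

/-! ## §4  (3.25) for the record's `R(U₀)` on the torus, on Hermitian inputs -/

section Formula

variable (τ : 𝔸 →ₗ[ℂ] ℂ) {P L : ℕ} [NeZero P] [NeZero L] {U₀ : Site d → Fin d → 𝔸ˣ} {η : ℝ} {m : ℕ} {a : ℕ → ℝ} {Λs : ℕ → Set (Site d)}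
  [FiniteDimensional ℝ 𝔸]

/-- ★★★ **(3.25) FOR THE RECORD'S `R(U₀)` ON `L²(T_P, 𝔤)`, HERMITIAN INPUTS**: for `f ∈ L²(T_P, ·)` Hermitian-valued (`f* = f`), at every UNITARY `P`-periodic background
`U₀` whose averaged transporters `Ū₀ʲ(Γ)` are unitary, `L ≥ 1`, `Lᵐ ∣ P`, level-periodic `Λ_j`, tracial Hermitian faithful `τ` on a finite-dimensional `𝔸`, in the
regime (`Δ′_a(U₀)` invertible, `Q′*` injective): `R(U₀)f = f − G′(Q′*((Q′G′²Q′*)⁻¹(Q′(G′f))))` — the orthogonal projection of (3.21)–(3.22)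
(`projEPer`, onto the span of `Δ^η_{U₀}λ`, `λ ∈ N_𝔤^per(Q′(U₀))`) IS print's Lagrange-multiplier formula. [cite: Balaban1985BackgroundPropagators, (3.25) p.394, (3.21)–(3.22) p.394; Balaban1984PropagatorsI, (1.42)–(1.44) p.25] -/
theorem projEPer_eq_RopPer_of_herm (hτt : ∀ a b : 𝔸, τ (a * b) = τ (b * a)) (hτs : ∀ a : 𝔸, τ (star a) = starRingEnd ℂ (τ a))
    (hτp : ∀ a : 𝔸, a ≠ 0 → 0 < (τ (star a * a)).re) (hL : 1 ≤ L)
    (hUu : ∀ (x : Site d) (κ : Fin d), U₀ x κ ∈ unitaryUnits 𝔸) (hT : ∀ (j : ℕ) (z y : Site d), bgT L U₀ j z y ∈ unitaryUnits 𝔸)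
    (hU : IsPeriodic P U₀) (hP : L ^ m ∣ P) (hΛ : ∀ j, j ≤ m → IsPeriodic (P / L ^ j) fun y => y ∈ Λs j)
    (hreg : RegularPrimePer L U₀ η m a Λs P) (hinj : QprimeStarPerInjective P L U₀ m Λs)
    {f : perSub (𝔸 := 𝔸) (d := d) P} (hf : starPerSub f = f) :
    projEPer τ P L m η Λs U₀ f = RopPer P L U₀ η m a Λs f := by
  classical
  have hb : Function.Bijective (qggqPer (𝔸 := 𝔸) (d := d) P L U₀ η m a Λs) := qggqPer_bijective τ hτt hτs hτp hUu hT hU hP hreg hinj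
  set R := RopPer P L U₀ η m a Λs f with hRdef
  set lam := GpPer L U₀ η m a Λs P R with hlam
  have hc := isCompl_rangeSubPer_orthogonal (P := P) (τ := τ) L m η Λs U₀ hτs hτp
  -- (i) `Rf ∈ Δ^η_{U₀}N_𝔤^per(Q′)`
  have hmem : R ∈ rangeSubPer P L m η Λs U₀ := by
    refine Submodule.subset_span ⟨(lam : Site d → 𝔸), ⟨?_, lam.2, ?_⟩, ?_⟩
    · exact fun x => isSelfAdjoint_lam0Per hUu hT hreg hb hf x
    · intro j hj y hy
      exact qprimeIter_GpPer_RopPer_eq_zero hU hP hΛ hb f hj hy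
    · exact coe_RopPer_eq_covLap hL hU hP hΛ hreg hb f
  -- (ii) `f − Rf ⊥ Δ^η_{U₀}N_𝔤^per(Q′)`
  have horth : f - R ∈ (formPer τ P).orthogonal (rangeSubPer P L m η Λs U₀) := by
    rw [LinearMap.BilinForm.mem_orthogonal_iff]
    intro w hw
    induction hw using Submodule.span_induction with
    | mem w hw =>
      obtain ⟨mu, ⟨_, hper, hQ⟩, hwmu⟩ := hw
      -- `w = Δμ = Δ′_a μ` since `Q′μ = 0` on the constraint sets
      set muS : perSub (𝔸 := 𝔸) (d := d) P := ⟨mu, hper⟩ with hmuS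
      have hQvec : QprimeVecPer P L U₀ m Λs muS = 0 := by
        apply Subtype.ext
        funext p
        obtain ⟨j, y⟩ := p
        rw [QprimeVecPer_apply, Submodule.coe_zero, Pi.zero_apply]
        split_ifs with h
        · exact hQ j h.1 _ h.2
        · rfl
      have hw' : w = deltaPrimeAPer L U₀ η m a Λs P muS := by
        apply Subtype.ext
        rw [hwmu, deltaPrimeAPer_coe η a hL hU hP hΛ muS, deltaPrimeAPerFun_of_ker hQ]
      show formPer τ P w (f - R) = 0
      rw [hw']
      exact formPer_deltaPrimeAPer_sub_RopPer τ hτt hτs hUu hT hU hP hreg muS hQvec f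
    | zero =>
      show formPer τ P 0 (f - R) = 0
      rw [map_zero, LinearMap.zero_apply]
    | add w₁ w₂ _ _ h₁ h₂ =>
      show formPer τ P (w₁ + w₂) (f - R) = 0
      have e₁ : formPer τ P w₁ (f - R) = 0 := h₁
      have e₂ : formPer τ P w₂ (f - R) = 0 := h₂
      rw [map_add, LinearMap.add_apply, e₁, e₂, add_zero]
    | smul c w _ hw =>
      show formPer τ P (c • w) (f - R) = 0
      have e : formPer τ P w (f - R) = 0 := hw
      rw [map_smul, LinearMap.smul_apply, e, smul_zero]
  -- (iii) uniqueness of the orthogonal decomposition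
  rw [projEPer_eq_projection L m η Λs U₀ hτs hτp]
  have hsplit : f = R + (f - R) := by abel
  conv_lhs => rw [hsplit]
  rw [map_add, Submodule.projection_apply_of_mem_left _ hmem, Submodule.projection_apply_of_mem_right _ horth, add_zero]

/-- ★★ **(3.25) FOR `projRPer` ON A PERIODIC HERMITIAN-VALUED SITE FUNCTION** (same hypotheses): `R(U₀)f` read on all functions is the coercion of `RopPer` at `⟨f, _⟩`.
[cite: Balaban1985BackgroundPropagators, (3.25) p.394, (3.21)–(3.22) p.394] -/
theorem coe_projRPer_eq_RopPer_of_herm (hτt : ∀ a b : 𝔸, τ (a * b) = τ (b * a)) (hτs : ∀ a : 𝔸, τ (star a) = starRingEnd ℂ (τ a))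
    (hτp : ∀ a : 𝔸, a ≠ 0 → 0 < (τ (star a * a)).re) (hL : 1 ≤ L)
    (hUu : ∀ (x : Site d) (κ : Fin d), U₀ x κ ∈ unitaryUnits 𝔸) (hT : ∀ (j : ℕ) (z y : Site d), bgT L U₀ j z y ∈ unitaryUnits 𝔸)
    (hU : IsPeriodic P U₀) (hP : L ^ m ∣ P) (hΛ : ∀ j, j ≤ m → IsPeriodic (P / L ^ j) fun y => y ∈ Λs j)
    (hreg : RegularPrimePer L U₀ η m a Λs P) (hinj : QprimeStarPerInjective P L U₀ m Λs)
    {f : Site d → 𝔸} (hf : IsPeriodic P f) (hsa : ∀ x, IsSelfAdjoint (f x)) :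
    projRPer τ P L m η Λs U₀ f = ((RopPer P L U₀ η m a Λs ⟨f, hf⟩ : perSub (𝔸 := 𝔸) (d := d) P) : Site d → 𝔸) := by
  have heq : (⟨perRestrict P f, perRestrict_mem_perSub P f⟩ : perSub (𝔸 := 𝔸) (d := d) P) = ⟨f, hf⟩ := Subtype.ext (perRestrict_eq_self P hf)
  have hstar : starPerSub (⟨f, hf⟩ : perSub (𝔸 := 𝔸) (d := d) P) = ⟨f, hf⟩ := by
    apply Subtype.ext
    funext x
    exact (hsa x).star_eq
  rw [projRPer, heq, projEPer_eq_RopPer_of_herm τ hτt hτs hτp hL hUu hT hU hP hΛ hreg hinj hstar]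

end Formula

end Literature.MathematicalPhysics.QuantumFieldTheory.Balaban1983to89.B9Eq325ProjFormulaZdPer

end
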